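import Mathlib
import Summits.ValiantsHypothesis.ValiantsHypothesis.Theorems.GrenetZeonTwoDimCoefficientsDualUnipotentCutLemma

/-!
# Crux `GrenetZeon.TwoDimCoefficients` (stmt-ValiantsHypothesis-8062) / rung `DualUnipotentThreeHalves` (stmt-24318):
# CUT SUBADDITIVITY of the centred cross form — no hypothesis on the numerator

✓ `rank_cross_const_le_of_cut` (`…CutLemma`) bounds the cross form `Ψ_p` of a nilpotent pencil with ONE invariant cut `D`
(`(1 − D)·N·D ≡ 0`) when the numerator `E` has no diagonal blocks.  This file removes the hypothesis on `E`: for an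
ARBITRARY constant `E`,

★★★ `rank_cross_const_le_cut_subadditive`:
  `rank Ψ_p[N, E] ≤ rank Ψ_U + rank Ψ_W + 3·m·rank(D·N(p)·(1 − D)) + 2·rank coeff(D·N·(1 − D))`,

where `Ψ_U(s,t) = tr(K_U·A_s·K_U·A_t·K_U·E)` with `K_U = D·K·D`, `A_s = D·N_s·D` is the cross form of the pencil COMPRESSED
to `U = range D` (its own resolvent is `(1 − D) + DKD`, and `(DN(p)D)^j = D·N(p)^j·D`, so this is literally the cross form
of the compressed pencil `D N D` with numerator `D E D`), and `Ψ_W` likewise for `W = ker D` (`D' = 1 − D`).  The block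
`D·E·D'` of the numerator is INVISIBLE (`tr(P·DED') = 0` for block-upper `P`); the block `D'·E·D` feeds the five cut terms
of ✓ `cut_five_terms`, bounded exactly as in ✓ `…CutLemma`; the diagonal blocks feed `Ψ_U`, `Ψ_W`
(`cut_compress`, `cut_compress'`, `trace_mul_eq_three`).  With ✓ `rank_hess0_resolvent_const_le_two_rank_cross`:
★ `rank_hess0_resolvent_const_le_cut_subadditive` — `rank Hess_p ≤ 2·(rank Ψ_U + rank Ψ_W) + 6m·rank(DN(p)D') + 4·rank coeff(DND')`.

USE: recursion along an invariant flag — (H) follows whenever the pencil has a flag all of whose connecting blocks are thin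
and whose compressed diagonal pencils satisfy (H); the residual core of R3′ is the IRREDUCIBLE nilpotent pencil
(no invariant subspace).  HONEST FRAMING: closes no stub — `stub_dualUnipotent`, 24318, `stub_longMassSlowLawInv`, `VP ≠ VNP`
untouched.  No definitions, no named facts, no sorry.
-/

noncomputable section

-- single-conjunct layout `Summits/ValiantsHypothesis/ValiantsHypothesis`: the duplicated namespace component is mandated
set_option linter.dupNamespace false

namespace Summit.ValiantsHypothesis.ValiantsHypothesis.Theorems.GrenetZeon.CutLemma

open MvPolynomial Matrix
open Literature.Computability.AlgebraicComplexity
open Summit.ValiantsHypothesis.ValiantsHypothesis.Theorems.GrenetZeon.ThinNumerator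
open Summit.ValiantsHypothesis.ValiantsHypothesis.Theorems.GrenetZeon.CentredNumerator
open Summit.ValiantsHypothesis.ValiantsHypothesis.Cruxes.TwoDimCoefficients.DimTwoCases (AffMat IsAffine)

/-! ### §1 Compression onto the two diagonal blocks -/

section Ring

variable {R : Type*} [Ring R]

/-- `D·(X·Y)·D = (DXD)·(DYD)` for block-upper `Y`. [folklore] -/
theorem cut_compress {D D' X Y : R} (h1 : D + D' = 1) (hD : D * D = D) (hK : D' * Y * D = 0) :
    D * (X * Y) * D = D * X * D * (D * Y * D) := by
  have e : Y * D = (D + D') * Y * D := by rw [h1, one_mul]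
  rw [add_mul, add_mul, hK, add_zero] at e
  calc D * (X * Y) * D = D * X * (Y * D) := by simp only [mul_assoc]
    _ = D * X * (D * Y * D) := by rw [← e]
    _ = D * X * ((D * D) * Y * D) := by rw [hD]
    _ = D * X * D * (D * Y * D) := by simp only [mul_assoc]

/-- `D'·(X·Y)·D' = (D'XD')·(D'YD')` for block-upper `X`. [folklore] -/
theorem cut_compress' {D D' X Y : R} (h1 : D + D' = 1) (hD' : D' * D' = D') (hX : D' * X * D = 0) :
    D' * (X * Y) * D' = D' * X * D' * (D' * Y * D') := by
  have e : D' * X = D' * X * (D + D') := by rw [h1, mul_one]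
  rw [mul_add, hX, zero_add] at e
  calc D' * (X * Y) * D' = (D' * X) * (Y * D') := by simp only [mul_assoc]
    _ = (D' * X * D') * (Y * D') := by rw [← e]
    _ = (D' * X * (D' * D')) * (Y * D') := by rw [hD']
    _ = D' * X * D' * (D' * Y * D') := by simp only [mul_assoc]

end Ring

section Three

variable {m : ℕ}

/-- For block-upper `Q` and ANY `E`: `tr(Q·E) = tr(DQD·E) + tr(D'QD'·E) + tr(DQD'·E)` (the fourth block pairs `DED'`
with `D'QD = 0`). [folklore] -/
theorem trace_mul_eq_three {D D' Q E : Matrix (Fin m) (Fin m) ℂ} (h1 : D + D' = 1) (hD : D * D = D)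
    (hQ : D' * Q * D = 0) :
    (Q * E).trace = (D * Q * D * E).trace + (D' * Q * D' * E).trace + (D * Q * D' * E).trace := by
  have hD'D : D' * D = 0 := by
    have e : D' = 1 - D := by rw [← h1, add_sub_cancel_left]
    rw [e, Matrix.sub_mul, Matrix.one_mul, hD, sub_self]
  have hDD' : D * D' = 0 := by
    have e : D' = 1 - D := by rw [← h1, add_sub_cancel_left]
    rw [e, Matrix.mul_sub, Matrix.mul_one, hD, sub_self]
  have hD' : D' * D' = D' := by
    have e : D' = 1 - D := by rw [← h1, add_sub_cancel_left]
    rw [e, Matrix.sub_mul, Matrix.one_mul, Matrix.mul_sub, Matrix.mul_one, hD, sub_self, sub_zero]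
  have eQ : Q = D * Q * D + D' * Q * D' + D * Q * D' := by
    have e : Q = (D + D') * Q * (D + D') := by rw [h1, Matrix.one_mul, Matrix.mul_one]
    have e2 : (D + D') * Q * (D + D') = D * Q * D + D' * Q * D' + D * Q * D' + D' * Q * D := by noncomm_ring
    rw [e2, hQ, add_zero] at e
    exact e
  conv_lhs => rw [eQ]
  rw [Matrix.add_mul, Matrix.add_mul, Matrix.trace_add, Matrix.trace_add]

end Three

/-! ### §2 Cut subadditivity -/

section Cut

variable {n m : ℕ}

/-- ★★★ **Cut subadditivity of the centred cross form** (see the module docstring). [folklore] -/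
theorem rank_cross_const_le_cut_subadditive (N : AffMat n m) (E D : Matrix (Fin m) (Fin m) ℂ) (hnil : N ^ m = 0)
    (hD : D * D = D)
    (hcutc : ∀ t : Fin n × Fin n, (1 - D) * N.map (coeff (Finsupp.single t 1)) * D = 0)
    (p : Fin n × Fin n → ℂ) (hcutp : (1 - D) * N.map (eval p) * D = 0) :
    (Matrix.of fun s t : Fin n × Fin n =>
        ((∑ j ∈ Finset.range m, N.map (eval p) ^ j) * N.map (coeff (Finsupp.single s 1)) *
          (∑ j ∈ Finset.range m, N.map (eval p) ^ j) *
          (N.map (coeff (Finsupp.single t 1)) * ((∑ j ∈ Finset.range m, N.map (eval p) ^ j) * E))).trace).rank ≤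
      (Matrix.of fun s t : Fin n × Fin n =>
        (D * (∑ j ∈ Finset.range m, N.map (eval p) ^ j) * D * (D * N.map (coeff (Finsupp.single s 1)) * D) *
          (D * (∑ j ∈ Finset.range m, N.map (eval p) ^ j) * D) * (D * N.map (coeff (Finsupp.single t 1)) * D) *
          (D * (∑ j ∈ Finset.range m, N.map (eval p) ^ j) * D) * E).trace).rank +
      (Matrix.of fun s t : Fin n × Fin n =>
        ((1 - D) * (∑ j ∈ Finset.range m, N.map (eval p) ^ j) * (1 - D) *
          ((1 - D) * N.map (coeff (Finsupp.single s 1)) * (1 - D)) *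
          ((1 - D) * (∑ j ∈ Finset.range m, N.map (eval p) ^ j) * (1 - D)) *
          ((1 - D) * N.map (coeff (Finsupp.single t 1)) * (1 - D)) *
          ((1 - D) * (∑ j ∈ Finset.range m, N.map (eval p) ^ j) * (1 - D)) * E).trace).rank +
      (3 * (m * (D * N.map (eval p) * (1 - D)).rank) +
        2 * (Matrix.of fun (lk : Fin m × Fin m) (t : Fin n × Fin n) =>
          coeff (Finsupp.single t 1)
            ((D.map (C : ℂ → MvPolynomial (Fin n × Fin n) ℂ) * N *
              (1 - D).map (C : ℂ → MvPolynomial (Fin n × Fin n) ℂ)) lk.1 lk.2)).rank) := by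
  set K : Matrix (Fin m) (Fin m) ℂ := ∑ j ∈ Finset.range m, N.map (eval p) ^ j with hK
  set P : Matrix (Fin m) (Fin m) ℂ := N.map (eval p) with hP
  set D' : Matrix (Fin m) (Fin m) ℂ := 1 - D with hD'def
  set Nc : Fin n × Fin n → Matrix (Fin m) (Fin m) ℂ := fun s => N.map (coeff (Finsupp.single s 1)) with hNc
  -- idempotent bookkeeping
  have h1 : D + D' = 1 := by rw [hD'def, add_sub_cancel]
  have hDD' : D * D' = 0 := by rw [hD'def, Matrix.mul_sub, Matrix.mul_one, hD, sub_self]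
  have hD'D : D' * D = 0 := by rw [hD'def, Matrix.sub_mul, Matrix.one_mul, hD, sub_self]
  have hD'2 : D' * D' = D' := by
    rw [hD'def, Matrix.sub_mul, Matrix.one_mul, Matrix.mul_sub, Matrix.mul_one, hD, sub_self, sub_zero]
  -- the resolvent `K` is the two-sided inverse of `1 − P`, and block-upper
  have hPm : P ^ m = 0 := map_eval_pow_eq_zero N hnil p
  have hK1 : K * (1 - P) = 1 := by rw [hK, geom_sum_mul_neg, hPm, sub_zero]
  have hK2 : (1 - P) * K = 1 := by rw [hK, mul_neg_geom_sum, hPm, sub_zero]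
  have hPcut : D' * P * D = 0 := hcutp
  have hKcut : D' * K * D = 0 :=
    cut_sum (Finset.range m) _ fun j _ => cut_pow h1 hD'D hPcut j
  -- the block-upper product `Q = K N_s K N_t K`
  have hQ : ∀ s t, D' * (K * Nc s * K * Nc t * K) * D = 0 := fun s t =>
    cut_mul h1 (cut_mul h1 (cut_mul h1 (cut_mul h1 hKcut (hcutc s)) hKcut) (hcutc t)) hKcut
  -- compression of the block-upper product onto `U` and onto `W`
  have hPU : ∀ s t, D * (K * Nc s * K * Nc t * K) * D =
      D * K * D * (D * Nc s * D) * (D * K * D) * (D * Nc t * D) * (D * K * D) := fun s t => by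
    rw [cut_compress h1 hD hKcut, cut_compress h1 hD (hcutc t), cut_compress h1 hD hKcut,
      cut_compress h1 hD (hcutc s)]
  have hPW : ∀ s t, D' * (K * Nc s * K * Nc t * K) * D' =
      D' * K * D' * (D' * Nc s * D') * (D' * K * D') * (D' * Nc t * D') * (D' * K * D') := fun s t => by
    rw [cut_compress' h1 hD'2 (cut_mul h1 (cut_mul h1 (cut_mul h1 hKcut (hcutc s)) hKcut) (hcutc t)),
      cut_compress' h1 hD'2 (cut_mul h1 (cut_mul h1 hKcut (hcutc s)) hKcut),
      cut_compress' h1 hD'2 (cut_mul h1 hKcut (hcutc s)), cut_compress' h1 hD'2 hKcut]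
  -- entrywise expansion: `U`-term + `W`-term + five cut terms
  have hentry : ∀ s t : Fin n × Fin n,
      (K * Nc s * K * (Nc t * (K * E))).trace =
        (D * K * D * (D * Nc s * D) * (D * K * D) * (D * Nc t * D) * (D * K * D) * E).trace +
        (D' * K * D' * (D' * Nc s * D') * (D' * K * D') * (D' * Nc t * D') * (D' * K * D') * E).trace +
        (((D * K * Nc s * D) * (D * K * Nc t * D) * (D * K * D * (D * P * D') * (D' * K * D') * E)).trace +
        ((D' * K * D' * E * (D * K * Nc s * D) * (D * K * D)) * 1 * (D * Nc t * D')).trace +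
        ((D' * K * D' * (D' * Nc t * D') * (D' * K * D') * E) * (D * K * Nc s * D * (D * K * D)) *
          (D * P * D')).trace +
        ((D' * (K * Nc t) * D' * (D' * K * D') * E * (D * K * D)) * 1 * (D * Nc s * D')).trace +
        ((D' * K * D' * (D' * Nc s * D')) * (D' * (K * Nc t) * D' * (D' * K * D') * E * (D * K * D)) *
          (D * P * D')).trace) := by
    intro s t
    rw [show K * Nc s * K * (Nc t * (K * E)) = (K * Nc s * K * Nc t * K) * E by simp only [Matrix.mul_assoc],
      trace_mul_eq_three h1 hD (hQ s t), hPU, hPW,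
      cut_five_terms h1 hDD' hD'D hD hD'2 hPcut hK1 hK2 hKcut (hcutc t)]
    simp only [Matrix.add_mul, Matrix.trace_add]
    rw [entry_T1, entry_T2a, entry_T2b, entry_T4a, entry_T4b]
  -- the seven matrices
  set MU : Matrix (Fin n × Fin n) (Fin n × Fin n) ℂ := Matrix.of fun s t =>
    (D * K * D * (D * Nc s * D) * (D * K * D) * (D * Nc t * D) * (D * K * D) * E).trace with hMU
  set MW : Matrix (Fin n × Fin n) (Fin n × Fin n) ℂ := Matrix.of fun s t =>
    (D' * K * D' * (D' * Nc s * D') * (D' * K * D') * (D' * Nc t * D') * (D' * K * D') * E).trace with hMW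
  set M1 : Matrix (Fin n × Fin n) (Fin n × Fin n) ℂ := Matrix.of fun s t =>
    ((D * K * Nc s * D) * (D * K * Nc t * D) * (D * K * D * (D * P * D') * (D' * K * D') * E)).trace with hM1
  set M2a : Matrix (Fin n × Fin n) (Fin n × Fin n) ℂ := Matrix.of fun s t =>
    ((D' * K * D' * E * (D * K * Nc s * D) * (D * K * D)) * 1 * (D * Nc t * D')).trace with hM2a
  set M2b : Matrix (Fin n × Fin n) (Fin n × Fin n) ℂ := Matrix.of fun s t =>
    ((D' * K * D' * (D' * Nc t * D') * (D' * K * D') * E) * (D * K * Nc s * D * (D * K * D)) *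
      (D * P * D')).trace with hM2b
  set M4a : Matrix (Fin n × Fin n) (Fin n × Fin n) ℂ := Matrix.of fun s t =>
    ((D' * (K * Nc t) * D' * (D' * K * D') * E * (D * K * D)) * 1 * (D * Nc s * D')).trace with hM4a
  set M4b : Matrix (Fin n × Fin n) (Fin n × Fin n) ℂ := Matrix.of fun s t =>
    ((D' * K * D' * (D' * Nc s * D')) * (D' * (K * Nc t) * D' * (D' * K * D') * E * (D * K * D)) *
      (D * P * D')).trace with hM4b
  have hsum : (Matrix.of fun s t : Fin n × Fin n => (K * Nc s * K * (Nc t * (K * E))).trace) =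
      MU + MW + (M1 + M2a + M2b + M4a + M4b) := by
    refine Matrix.ext fun s t => ?_
    simp only [hMU, hMW, hM1, hM2a, hM2b, hM4a, hM4b, Matrix.add_apply, Matrix.of_apply]
    exact hentry s t
  -- the connecting block is the coefficient of the affine matrix `D·N·D'`
  have hcoeff : ∀ t : Fin n × Fin n,
      (D.map (C : ℂ → MvPolynomial (Fin n × Fin n) ℂ) * N *
        (1 - D).map (C : ℂ → MvPolynomial (Fin n × Fin n) ℂ)).map (coeff (Finsupp.single t 1)) = D * Nc t * D' := by
    intro t
    rw [map_coeff_mul_map_C, map_coeff_map_C_mul]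
  -- rank of the connecting-block factors
  have hrb1 : (D * K * D * (D * P * D') * (D' * K * D') * E).rank ≤ (D * P * D').rank :=
    (Matrix.rank_mul_le_left _ _).trans ((Matrix.rank_mul_le_left _ _).trans (Matrix.rank_mul_le_right _ _))
  have hrb2 : (D * P * D').rank ≤ (D * P * D').rank := le_rfl
  -- the five bounds
  have b1 : M1.rank ≤ m * (D * P * D').rank :=
    (rank_of_trace_mul_mul_le₂ (fun s => D * K * Nc s * D) (fun t => D * K * Nc t * D) _).trans
      (Nat.mul_le_mul_left m hrb1)
  have b2a : M2a.rank ≤ (Matrix.of fun (lk : Fin m × Fin m) (t : Fin n × Fin n) =>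
      coeff (Finsupp.single t 1) ((D.map (C : ℂ → MvPolynomial (Fin n × Fin n) ℂ) * N *
        (1 - D).map (C : ℂ → MvPolynomial (Fin n × Fin n) ℂ)) lk.1 lk.2)).rank := by
    have h := rank_of_trace_mul_mul_coeff_le (fun s => D' * K * D' * E * (D * K * Nc s * D) * (D * K * D)) 1
      (D.map (C : ℂ → MvPolynomial (Fin n × Fin n) ℂ) * N * (1 - D).map (C : ℂ → MvPolynomial (Fin n × Fin n) ℂ))
    have e : (Matrix.of fun s t : Fin n × Fin n => (D' * K * D' * E * (D * K * Nc s * D) * (D * K * D) * 1 *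
        (D.map (C : ℂ → MvPolynomial (Fin n × Fin n) ℂ) * N *
          (1 - D).map (C : ℂ → MvPolynomial (Fin n × Fin n) ℂ)).map (coeff (Finsupp.single t 1))).trace) = M2a := by
      refine Matrix.ext fun s t => ?_
      rw [Matrix.of_apply, hM2a, Matrix.of_apply, hcoeff t]
    rw [e] at h
    exact h
  have b2b : M2b.rank ≤ m * (D * P * D').rank := by
    have h := rank_of_trace_mul_mul_le₂ (fun t => D' * K * D' * (D' * Nc t * D') * (D' * K * D') * E)
      (fun s => D * K * Nc s * D * (D * K * D)) (D * P * D')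
    have e : (Matrix.of fun t s : Fin n × Fin n => (D' * K * D' * (D' * Nc t * D') * (D' * K * D') * E *
        (D * K * Nc s * D * (D * K * D)) * (D * P * D')).trace) = M2bᵀ := by
      refine Matrix.ext fun t s => ?_
      rw [Matrix.of_apply, Matrix.transpose_apply, hM2b, Matrix.of_apply]
    rw [e, Matrix.rank_transpose] at h
    exact h
  have b4a : M4a.rank ≤ (Matrix.of fun (lk : Fin m × Fin m) (t : Fin n × Fin n) =>
      coeff (Finsupp.single t 1) ((D.map (C : ℂ → MvPolynomial (Fin n × Fin n) ℂ) * N *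
        (1 - D).map (C : ℂ → MvPolynomial (Fin n × Fin n) ℂ)) lk.1 lk.2)).rank := by
    have h := rank_of_trace_mul_mul_coeff_le (fun t => D' * (K * Nc t) * D' * (D' * K * D') * E * (D * K * D)) 1
      (D.map (C : ℂ → MvPolynomial (Fin n × Fin n) ℂ) * N * (1 - D).map (C : ℂ → MvPolynomial (Fin n × Fin n) ℂ))
    have e : (Matrix.of fun t s : Fin n × Fin n => (D' * (K * Nc t) * D' * (D' * K * D') * E * (D * K * D) * 1 *
        (D.map (C : ℂ → MvPolynomial (Fin n × Fin n) ℂ) * N *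
          (1 - D).map (C : ℂ → MvPolynomial (Fin n × Fin n) ℂ)).map (coeff (Finsupp.single s 1))).trace) = M4aᵀ := by
      refine Matrix.ext fun t s => ?_
      rw [Matrix.of_apply, Matrix.transpose_apply, hM4a, Matrix.of_apply, hcoeff s]
    rw [e, Matrix.rank_transpose] at h
    exact h
  have b4b : M4b.rank ≤ m * (D * P * D').rank :=
    rank_of_trace_mul_mul_le₂ (fun s => D' * K * D' * (D' * Nc s * D'))
      (fun t => D' * (K * Nc t) * D' * (D' * K * D') * E * (D * K * D)) (D * P * D')
  -- assemble
  have eNc : (Matrix.of fun s t : Fin n × Fin n =>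
      ((∑ j ∈ Finset.range m, N.map (eval p) ^ j) * N.map (coeff (Finsupp.single s 1)) *
        (∑ j ∈ Finset.range m, N.map (eval p) ^ j) *
        (N.map (coeff (Finsupp.single t 1)) * ((∑ j ∈ Finset.range m, N.map (eval p) ^ j) * E))).trace) =
      Matrix.of fun s t : Fin n × Fin n => (K * Nc s * K * (Nc t * (K * E))).trace := rfl
  rw [eNc, hsum, hD'def] at *
  have h5 : (M1 + M2a + M2b + M4a + M4b).rank ≤ M1.rank + M2a.rank + M2b.rank + M4a.rank + M4b.rank :=
    (rank_add_le' _ _).trans (Nat.add_le_add_right ((rank_add_le' _ _).trans (Nat.add_le_add_right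
      ((rank_add_le' _ _).trans (Nat.add_le_add_right (rank_add_le' _ _) _)) _)) _)
  calc (MU + MW + (M1 + M2a + M2b + M4a + M4b)).rank
      ≤ MU.rank + MW.rank + (M1 + M2a + M2b + M4a + M4b).rank :=
        (rank_add_le' _ _).trans (Nat.add_le_add_right (rank_add_le' _ _) _)
    _ ≤ _ := by omega


/-- ★ **Hessian form of cut subadditivity.**  Same hypotheses (`N` affine):
`rank Hess_p Σ_{j<m} tr(N^j·E) ≤ 2·(rank Ψ_U + rank Ψ_W) + 6·m·rank(D·N(p)·(1 − D)) + 4·rank coeff(D·N·(1 − D))`.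
[folklore] -/
theorem rank_hess0_resolvent_const_le_cut_subadditive (N : AffMat n m) (hN : IsAffine N)
    (E D : Matrix (Fin m) (Fin m) ℂ) (hnil : N ^ m = 0) (hD : D * D = D)
    (hcutc : ∀ t : Fin n × Fin n, (1 - D) * N.map (coeff (Finsupp.single t 1)) * D = 0)
    (p : Fin n × Fin n → ℂ) (hcutp : (1 - D) * N.map (eval p) * D = 0) :
    (hess0 (transl p (∑ j ∈ Finset.range m, (N ^ j * E.map C).trace))).rank ≤
      2 * ((Matrix.of fun s t : Fin n × Fin n =>
        (D * (∑ j ∈ Finset.range m, N.map (eval p) ^ j) * D * (D * N.map (coeff (Finsupp.single s 1)) * D) *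
          (D * (∑ j ∈ Finset.range m, N.map (eval p) ^ j) * D) * (D * N.map (coeff (Finsupp.single t 1)) * D) *
          (D * (∑ j ∈ Finset.range m, N.map (eval p) ^ j) * D) * E).trace).rank +
      (Matrix.of fun s t : Fin n × Fin n =>
        ((1 - D) * (∑ j ∈ Finset.range m, N.map (eval p) ^ j) * (1 - D) *
          ((1 - D) * N.map (coeff (Finsupp.single s 1)) * (1 - D)) *
          ((1 - D) * (∑ j ∈ Finset.range m, N.map (eval p) ^ j) * (1 - D)) *
          ((1 - D) * N.map (coeff (Finsupp.single t 1)) * (1 - D)) *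
          ((1 - D) * (∑ j ∈ Finset.range m, N.map (eval p) ^ j) * (1 - D)) * E).trace).rank) +
      (6 * (m * (D * N.map (eval p) * (1 - D)).rank) +
        4 * (Matrix.of fun (lk : Fin m × Fin m) (t : Fin n × Fin n) =>
          coeff (Finsupp.single t 1)
            ((D.map (C : ℂ → MvPolynomial (Fin n × Fin n) ℂ) * N *
              (1 - D).map (C : ℂ → MvPolynomial (Fin n × Fin n) ℂ)) lk.1 lk.2)).rank) := by
  have h := rank_hess0_resolvent_const_le_two_rank_cross N hN E hnil p
  have h2 := rank_cross_const_le_cut_subadditive N E D hnil hD hcutc p hcutp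
  omega

end Cut

end Summit.ValiantsHypothesis.ValiantsHypothesis.Theorems.GrenetZeon.CutLemma

end
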